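import Mathlib
import Summits.ValiantsHypothesis.ValiantsHypothesis.Theorems.ProofCarryingSymmetryRestorationQPPCRealizable

/-!
# Route ProofCarryingSymmetry — crux `RestorationQP`, line `registered`: prefixes, unsharing and dead-weight elimination in `P_c`

Necessity of the provability stub T′ (`stub_invarianceProvableQP'`), part 3.  Proof-DAG macros
(`PCR.Real`, part 1) specific to Hrubeš–Tzameret CIRCUITS:

* `PCR.pre B i` — the subcircuit `F_i` of a straight-line body `B` (the initial segment ending at
  node `i`; it keeps the earlier nodes not reachable from `i` as DEAD WEIGHT), `pre_rename`,
  `prefixAt_pre`, sizes;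
* `Real.unshareAdd / unshareMul` — the C1/C2 instances `F_i = F_a + F_b` for a gate `i = a ∘ b`;
* over a commutative RING of constants: `Real.negOne` (`A + A·(−1) = 0`), `Real.expand`
  (`R = (A + R) + A·(−1)`), `Real.cancel` (`A + P = A + Q ⊢ P = Q`), and the **dead-weight
  elimination at a leaf** `Real.preLeaf`: `F_i = ℓ` for a leaf node `ℓ` at position `i`, by the
  C1 instance `F_{i-1} + ℓ = F_{i-1} + F_i` (the two sides are literally the same circuit) and
  cancellation of `F_{i-1}` — the only place where the simulation needs A6–A10 (in the AC
  fragment dead weight is rigid, which is why the line's stability pair is typed over unfoldings).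

Everything proved, no named facts.
-/

-- single-problem summit: `Summit.ValiantsHypothesis.ValiantsHypothesis.…` is the namespace by design (D-0017)
set_option linter.dupNamespace false

namespace Summit.ValiantsHypothesis.ValiantsHypothesis.Theorems

namespace PCR

open Literature.Computability.AlgebraicComplexity PICircuit

universe u v w

variable {𝔽 : Type u} {X : Type v} {Y : Type w}

/-! ### Prefix circuits of a body -/

section Pre

variable [Zero 𝔽]

/-- `pre B i`: the subcircuit of the straight-line body `B` with output node `i` — the initial
segment `B.take i` followed by node `i` (junk `0` past the end); this is `PICircuit.prefixAt` of any
circuit with body `B`. [folklore] -/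
def pre (B : List (Node 𝔽 X)) (i : ℕ) : PICircuit 𝔽 X := ⟨B.take i, B.getD i (.const 0)⟩

/-- `pre` is `prefixAt`. [folklore] -/
theorem prefixAt_eq_pre (B : List (Node 𝔽 X)) (out : Node 𝔽 X) (i : ℕ) :
    (⟨B, out⟩ : PICircuit 𝔽 X).prefixAt i = pre B i := rfl

/-- The body of `pre B i`. [folklore] -/
@[simp] theorem pre_body (B : List (Node 𝔽 X)) (i : ℕ) : (pre B i).body = B.take i := rfl

/-- The output node of `pre B i`. [folklore] -/
@[simp] theorem pre_out (B : List (Node 𝔽 X)) (i : ℕ) : (pre B i).out = B.getD i (.const 0) := rfl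

/-- `|pre B i| ≤ |B| + 1`. [folklore] -/
theorem size_pre_le (B : List (Node 𝔽 X)) (i : ℕ) : (pre B i).size ≤ B.length + 1 := by
  simp only [PICircuit.size, pre_body, List.length_take]; omega

/-- `|pre B i| = i + 1` inside the body. [folklore] -/
theorem size_pre (B : List (Node 𝔽 X)) {i : ℕ} (hi : i ≤ B.length) : (pre B i).size = i + 1 := by
  simp only [PICircuit.size, pre_body, List.length_take]; omega

/-- Renaming a prefix is the prefix of the renamed body. [folklore] -/
theorem pre_rename (ρ : X → Y) (B : List (Node 𝔽 X)) (i : ℕ) :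
    (pre B i).rename ρ = pre (B.map (Node.rename ρ)) i := by
  simp only [pre, PICircuit.rename, List.map_take, PICircuit.mk.injEq, true_and]
  exact (List.getD_map B (Node.const 0) (Node.rename ρ)).symm

/-- Nodes of a renamed body. [folklore] -/
theorem getD_map_rename (ρ : X → Y) (B : List (Node 𝔽 X)) (i : ℕ) :
    (B.map (Node.rename ρ)).getD i (.const 0) = (B.getD i (.const 0)).rename ρ :=
  List.getD_map B (Node.const 0) (Node.rename ρ)

omit [Zero 𝔽] in
/-- A renamed body has the same length. [folklore] -/
theorem length_map_rename (ρ : X → Y) (B : List (Node 𝔽 X)) : (B.map (Node.rename ρ)).length = B.length :=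
  List.length_map _

/-- Earlier nodes of a prefix. [folklore] -/
theorem getD_take_of_lt (B : List (Node 𝔽 X)) {a i : ℕ} (ha : a < i) :
    (B.take i).getD a (.const 0) = B.getD a (.const 0) := by
  simp [List.getD_eq_getElem?_getD, ha]

/-- Prefixes of prefixes. [folklore] -/
theorem prefixAt_pre (B : List (Node 𝔽 X)) {a i : ℕ} (ha : a < i) : (pre B i).prefixAt a = pre B a := by
  simp only [PICircuit.prefixAt, List.take_take, min_eq_left ha.le, pre, PICircuit.mk.injEq, true_and]
  exact getD_take_of_lt B ha

/-- **C1 at a gate of a body**: if node `i` is `a + b` with `a, b < i`, then `F_i = F_a + F_b` is an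
instance of C1. [folklore] -/
theorem isExtra_pre_add {B : List (Node 𝔽 X)} {i a b : ℕ} (hn : B.getD i (.const 0) = .add a b)
    (ha : a < i) (hb : b < i) : IsExtra .C1 (pre B i) (PICircuit.add (pre B a) (pre B b)) := by
  have h := IsExtra.c1 (𝔽 := 𝔽) (B.take i) a b
  have e : (⟨B.take i, .add a b⟩ : PICircuit 𝔽 X) = pre B i := by rw [pre, hn]
  rw [e, prefixAt_pre B ha, prefixAt_pre B hb] at h
  exact h

/-- **C2 at a gate of a body**: if node `i` is `a × b` with `a, b < i`, then `F_i = F_a · F_b` is an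
instance of C2. [folklore] -/
theorem isExtra_pre_mul {B : List (Node 𝔽 X)} {i a b : ℕ} (hn : B.getD i (.const 0) = .mul a b)
    (ha : a < i) (hb : b < i) : IsExtra .C2 (pre B i) (PICircuit.mul (pre B a) (pre B b)) := by
  have h := IsExtra.c2 (𝔽 := 𝔽) (B.take i) a b
  have e : (⟨B.take i, .mul a b⟩ : PICircuit 𝔽 X) = pre B i := by rw [pre, hn]
  rw [e, prefixAt_pre B ha, prefixAt_pre B hb] at h
  exact h

end Pre

/-! ### Unsharing a gate, as a proof-DAG step -/

section Unshare

variable [CommSemiring 𝔽]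

/-- **Unsharing a `+` gate** (C1): realize `F_i = F_a + F_b`, cost `≤ 4M` for `M ≥ |B| + 1`.
[folklore] -/
theorem Real.unshareAdd {L : List (PICircuit 𝔽 X × PICircuit 𝔽 X)} {n : ℕ}
    (h : Real (pcSystem 𝔽 X) L n) {B : List (Node 𝔽 X)} {i a b : ℕ}
    (hn : B.getD i (.const 0) = .add a b) (ha : a < i) (hb : b < i) {M : ℕ} (hM : B.length + 1 ≤ M) :
    Real (pcSystem 𝔽 X) ((pre B i, PICircuit.add (pre B a) (pre B b)) :: L) (n + 4 * M) := by
  have h1 := size_pre_le B i; have h2 := size_pre_le B a; have h3 := size_pre_le B b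
  refine (h.axm (s := .C1) (.inr (isExtra_pre_add hn ha hb))).mono (List.Subset.refl _) ?_
  simp only [pcSystem, PICircuit.size_add]; omega

/-- **Unsharing a `×` gate** (C2): realize `F_i = F_a · F_b`, cost `≤ 4M` for `M ≥ |B| + 1`.
[folklore] -/
theorem Real.unshareMul {L : List (PICircuit 𝔽 X × PICircuit 𝔽 X)} {n : ℕ}
    (h : Real (pcSystem 𝔽 X) L n) {B : List (Node 𝔽 X)} {i a b : ℕ}
    (hn : B.getD i (.const 0) = .mul a b) (ha : a < i) (hb : b < i) {M : ℕ} (hM : B.length + 1 ≤ M) :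
    Real (pcSystem 𝔽 X) ((pre B i, PICircuit.mul (pre B a) (pre B b)) :: L) (n + 4 * M) := by
  have h1 := size_pre_le B i; have h2 := size_pre_le B a; have h3 := size_pre_le B b
  refine (h.axm (s := .C2) (.inr (isExtra_pre_mul hn ha hb))).mono (List.Subset.refl _) ?_
  simp only [pcSystem, PICircuit.size_mul]; omega

end Unshare

/-! ### Dead-weight elimination (commutative ring of constants) -/

section Ring

variable [CommRing 𝔽]

/-- **`A + A·(−1) = 0`**, realized in `P_c` (A9, A6, A10, A8), cost `≤ 30M` for `M ≥ 2|A| + 5`.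
[folklore] -/
theorem Real.negOne {L : List (PICircuit 𝔽 X × PICircuit 𝔽 X)} {n : ℕ} (h : Real (pcSystem 𝔽 X) L n)
    (A : PICircuit 𝔽 X) {M : ℕ} (hM : 2 * A.size + 5 ≤ M) :
    Real (pcSystem 𝔽 X)
      ((PICircuit.add A (PICircuit.mul A (PICircuit.const (-1))), PICircuit.const 0) :: L) (n + 30 * M) := by
  -- sizes
  have s0 : ∀ c : 𝔽, (pcSystem 𝔽 X).size (PICircuit.const c) ≤ M := fun c => by
    simp only [pcSystem, PICircuit.size_const]; omega
  have sA : (pcSystem 𝔽 X).size A ≤ M := by simp only [pcSystem]; omega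
  have s1 : ∀ c : 𝔽, (pcSystem 𝔽 X).size (PICircuit.mul A (PICircuit.const c)) ≤ M := fun c => by
    simp only [pcSystem, PICircuit.size_mul, PICircuit.size_const]; omega
  have s2 : (pcSystem 𝔽 X).size (PICircuit.add A (PICircuit.mul A (PICircuit.const (-1)))) ≤ M := by
    simp only [pcSystem, PICircuit.size_add, PICircuit.size_mul, PICircuit.size_const]; omega
  have s3 : (pcSystem 𝔽 X).size (PICircuit.add (PICircuit.mul A (PICircuit.const 1))
      (PICircuit.mul A (PICircuit.const (-1)))) ≤ M := by
    simp only [pcSystem, PICircuit.size_add, PICircuit.size_mul, PICircuit.size_const]; omega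
  have s4 : (pcSystem 𝔽 X).size (PICircuit.add (PICircuit.const (1 : 𝔽)) (PICircuit.const (-1))) ≤ M := by
    simp only [pcSystem, PICircuit.size_add, PICircuit.size_const]; omega
  have s5 : (pcSystem 𝔽 X).size (PICircuit.mul A (PICircuit.add (PICircuit.const (1 : 𝔽))
      (PICircuit.const (-1)))) ≤ M := by
    simp only [pcSystem, PICircuit.size_add, PICircuit.size_mul, PICircuit.size_const]; omega
  -- axiom instances (stated in the system's vocabulary)
  have ax9 : (pcSystem 𝔽 X).IsAxiom .A9 (PICircuit.mul A (PICircuit.const 1)) A := .inl (.a9 A)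
  have ax6 : (pcSystem 𝔽 X).IsAxiom .A6
      (PICircuit.mul A (PICircuit.add (PICircuit.const 1) (PICircuit.const (-1))))
      (PICircuit.add (PICircuit.mul A (PICircuit.const 1)) (PICircuit.mul A (PICircuit.const (-1)))) :=
    .inl (.a6 A _ _)
  have ax10 : (pcSystem 𝔽 X).IsAxiom .A10 (PICircuit.const (0 : 𝔽))
      (PICircuit.add (PICircuit.const 1) (PICircuit.const (-1))) :=
    .inl (.a10_add 0 1 (-1) (by ring))
  have ax8 : (pcSystem 𝔽 X).IsAxiom .A8 (PICircuit.mul A (PICircuit.const 0)) (PICircuit.const 0) :=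
    .inl (.a8 A)
  -- l1: (A, A·1)   [A9⁻¹]
  have r1 := h.axmSymmB ax9 (s1 1) sA
  -- l2: (A·(−1), A·(−1));  l3: (A + A·(−1), A·1 + A·(−1))
  have r2 := r1.reflB (PICircuit.mul A (PICircuit.const (-1))) (s1 _)
  have r3 := r2.congrAddB (List.mem_cons_of_mem _ List.mem_cons_self) List.mem_cons_self s2 s3
  -- l4: (A·1 + A·(−1), A·(1 + (−1)))   [A6⁻¹]
  have r4 := r3.axmSymmB ax6 s5 s3
  -- l5: (1 + (−1), 0)  [A10⁻¹];  l6: (A, A);  l7: (A·(1 + (−1)), A·0)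
  have r5 := r4.axmSymmB ax10 (s0 0) s4
  have r6 := r5.reflB A sA
  have r7 := r6.congrMulB List.mem_cons_self (List.mem_cons_of_mem _ List.mem_cons_self) s5 (s1 0)
  -- l8: (A·0, 0) [A8]
  have r8 := r7.axmB ax8 (s1 0) (s0 0)
  -- chain l3, l4, l7, l8
  have r9 := r8.trans₄ (M := PICircuit.const 0)
    (List.mem_cons_of_mem _ (List.mem_cons_of_mem _ (List.mem_cons_of_mem _
      (List.mem_cons_of_mem _ (List.mem_cons_of_mem _ List.mem_cons_self)))))
    (List.mem_cons_of_mem _ (List.mem_cons_of_mem _ (List.mem_cons_of_mem _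
      (List.mem_cons_of_mem _ List.mem_cons_self))))
    (List.mem_cons_of_mem _ List.mem_cons_self) List.mem_cons_self s2 s5 (s1 0) (s0 0)
  refine r9.mono (List.cons_subset_cons _ fun e he => ?_) (by omega)
  iterate 8 apply List.mem_cons_of_mem
  exact he

/-- **Expansion** `R = (A + R) + A·(−1)`, realized from the line `0 = A + A·(−1)`, cost `≤ 24M`
for `M ≥ |R| + 2|A| + 5`. [folklore] -/
theorem Real.expand {L : List (PICircuit 𝔽 X × PICircuit 𝔽 X)} {n : ℕ} (h : Real (pcSystem 𝔽 X) L n)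
    {A : PICircuit 𝔽 X}
    (hneg : (PICircuit.const 0, PICircuit.add A (PICircuit.mul A (PICircuit.const (-1)))) ∈ L)
    (R : PICircuit 𝔽 X) {M : ℕ} (hM : R.size + 2 * A.size + 5 ≤ M) :
    Real (pcSystem 𝔽 X)
      ((R, PICircuit.add (PICircuit.add A R) (PICircuit.mul A (PICircuit.const (-1)))) :: L) (n + 24 * M) := by
  have sR : (pcSystem 𝔽 X).size R ≤ M := by simp only [pcSystem]; omega
  have sR0 : (pcSystem 𝔽 X).size (PICircuit.add R (PICircuit.const 0)) ≤ M := by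
    simp only [pcSystem, PICircuit.size_add, PICircuit.size_const]; omega
  have sAm : (pcSystem 𝔽 X).size (PICircuit.mul A (PICircuit.const (-1 : 𝔽))) ≤ M := by
    simp only [pcSystem, PICircuit.size_mul, PICircuit.size_const]; omega
  have sT1 : (pcSystem 𝔽 X).size (PICircuit.add R (PICircuit.add A (PICircuit.mul A (PICircuit.const (-1))))) ≤ M := by
    simp only [pcSystem, PICircuit.size_add, PICircuit.size_mul, PICircuit.size_const]; omega
  have sT2 : (pcSystem 𝔽 X).size (PICircuit.add (PICircuit.add R A) (PICircuit.mul A (PICircuit.const (-1)))) ≤ M := by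
    simp only [pcSystem, PICircuit.size_add, PICircuit.size_mul, PICircuit.size_const]; omega
  have sT3 : (pcSystem 𝔽 X).size (PICircuit.add (PICircuit.add A R) (PICircuit.mul A (PICircuit.const (-1)))) ≤ M := by
    simp only [pcSystem, PICircuit.size_add, PICircuit.size_mul, PICircuit.size_const]; omega
  have sRA : (pcSystem 𝔽 X).size (PICircuit.add R A) ≤ M := by
    simp only [pcSystem, PICircuit.size_add]; omega
  have sAR : (pcSystem 𝔽 X).size (PICircuit.add A R) ≤ M := by
    simp only [pcSystem, PICircuit.size_add]; omega
  have ax7 : (pcSystem 𝔽 X).IsAxiom .A7 (PICircuit.add R (PICircuit.const 0)) R := .inl (.a7 R)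
  have ax3 : (pcSystem 𝔽 X).IsAxiom .A3
      (PICircuit.add R (PICircuit.add A (PICircuit.mul A (PICircuit.const (-1)))))
      (PICircuit.add (PICircuit.add R A) (PICircuit.mul A (PICircuit.const (-1)))) := .inl (.a3 R A _)
  have ax2 : (pcSystem 𝔽 X).IsAxiom .A2 (PICircuit.add R A) (PICircuit.add A R) := .inl (.a2 R A)
  -- e1: (R, R + 0);  e2: (R + 0, R + (A + A(−1)));  e3: (R + A, A + R);  e4: ((R + A) + A(−1), (A + R) + A(−1))
  have r1 := h.axmSymmB ax7 sR0 sR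
  have r2 := r1.congrAddLeft R (List.mem_cons_of_mem _ hneg) sR0 sT1 sR
  have r3 := r2.axmB ax2 sRA sAR
  have r4 := r3.congrAddRight (PICircuit.mul A (PICircuit.const (-1))) List.mem_cons_self sT2 sT3 sAm
  -- e5: (R + (A + A(−1)), (R + A) + A(−1)) [A3];  chain e1 e2 e5 e4
  have r5 := r4.axmB ax3 sT1 sT2
  have r6 := r5.trans₄
    (List.mem_cons_of_mem _ (List.mem_cons_of_mem _ (List.mem_cons_of_mem _
      (List.mem_cons_of_mem _ List.mem_cons_self))))
    (List.mem_cons_of_mem _ (List.mem_cons_of_mem _ (List.mem_cons_of_mem _ List.mem_cons_self)))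
    List.mem_cons_self (List.mem_cons_of_mem _ List.mem_cons_self) sR sT1 sT2 sT3
  refine r6.mono (List.cons_subset_cons _ fun e he => ?_) (by omega)
  iterate 5 apply List.mem_cons_of_mem
  exact he

/-- **Cancellation**: from a realized line `A + P = A + Q` realize `P = Q`, cost `≤ 90M` for
`M ≥ |P| + |Q| + 2|A| + 5`. [folklore] -/
theorem Real.cancel {L : List (PICircuit 𝔽 X × PICircuit 𝔽 X)} {n : ℕ} (h : Real (pcSystem 𝔽 X) L n)
    {A P Q : PICircuit 𝔽 X} (hm : (PICircuit.add A P, PICircuit.add A Q) ∈ L) {M : ℕ}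
    (hM : P.size + Q.size + 2 * A.size + 5 ≤ M) : Real (pcSystem 𝔽 X) ((P, Q) :: L) (n + 90 * M) := by
  have sP : (pcSystem 𝔽 X).size P ≤ M := by simp only [pcSystem]; omega
  have sQ : (pcSystem 𝔽 X).size Q ≤ M := by simp only [pcSystem]; omega
  have s0 : (pcSystem 𝔽 X).size (PICircuit.const (0 : 𝔽)) ≤ M := by
    simp only [pcSystem, PICircuit.size_const]; omega
  have sN : (pcSystem 𝔽 X).size (PICircuit.add A (PICircuit.mul A (PICircuit.const (-1 : 𝔽)))) ≤ M := by
    simp only [pcSystem, PICircuit.size_add, PICircuit.size_mul, PICircuit.size_const]; omega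
  have sAm : (pcSystem 𝔽 X).size (PICircuit.mul A (PICircuit.const (-1 : 𝔽))) ≤ M := by
    simp only [pcSystem, PICircuit.size_mul, PICircuit.size_const]; omega
  have sXP : (pcSystem 𝔽 X).size (PICircuit.add (PICircuit.add A P) (PICircuit.mul A (PICircuit.const (-1)))) ≤ M := by
    simp only [pcSystem, PICircuit.size_add, PICircuit.size_mul, PICircuit.size_const]; omega
  have sXQ : (pcSystem 𝔽 X).size (PICircuit.add (PICircuit.add A Q) (PICircuit.mul A (PICircuit.const (-1)))) ≤ M := by
    simp only [pcSystem, PICircuit.size_add, PICircuit.size_mul, PICircuit.size_const]; omega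
  -- n1: (A + A(−1), 0);  n2: (0, A + A(−1))
  have r1 := h.negOne A (M := M) (by omega)
  have r2 := r1.symmB List.mem_cons_self sN s0
  -- xP: (P, (A+P) + A(−1));  xQ: (Q, (A+Q) + A(−1))
  have r3 := r2.expand List.mem_cons_self P (M := M) (by omega)
  have r4 := r3.expand (List.mem_cons_of_mem _ List.mem_cons_self) Q (M := M) (by omega)
  -- c: ((A+P) + A(−1), (A+Q) + A(−1));  xQ': ((A+Q) + A(−1), Q)
  have r5 := r4.congrAddRight (PICircuit.mul A (PICircuit.const (-1)))
    (List.mem_cons_of_mem _ (List.mem_cons_of_mem _ (List.mem_cons_of_mem _ (List.mem_cons_of_mem _ hm))))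
    sXP sXQ sAm
  have r6 := r5.symmB (List.mem_cons_of_mem _ List.mem_cons_self) sQ sXQ
  -- chain xP, c, xQ'
  have sXQ' : (pcSystem 𝔽 X).size ((pcSystem 𝔽 X).add (PICircuit.add A Q)
      (PICircuit.mul A (PICircuit.const (-1)))) ≤ M := sXQ
  have r7 := r6.trans₃ (List.mem_cons_of_mem _ (List.mem_cons_of_mem _ (List.mem_cons_of_mem _ List.mem_cons_self)))
    (List.mem_cons_of_mem _ List.mem_cons_self) List.mem_cons_self sP sXQ' sQ
  refine r7.mono (List.cons_subset_cons _ fun e he => ?_) (by omega)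
  iterate 6 apply List.mem_cons_of_mem
  exact he

/-- The disjoint sum of a prefix `F_{i-1}` and a LEAF circuit `ℓ` is literally the body
`B.take i ++ [ℓ]` with output node `(i-1) + i`. [folklore] -/
theorem add_pre_leaf (B : List (Node 𝔽 X)) {i : ℕ} (h1 : 1 ≤ i) (hi : i ≤ B.length) (ℓ : Node 𝔽 X)
    (hleaf : ∀ k, ℓ.shift k = ℓ) :
    PICircuit.add (pre B (i - 1)) ⟨[], ℓ⟩ = ⟨B.take i ++ [ℓ], .add (i - 1) i⟩ := by
  obtain ⟨j, rfl⟩ : ∃ j, i = j + 1 := ⟨i - 1, by omega⟩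
  have hj : j < B.length := by omega
  simp only [PICircuit.add, PICircuit.nodes, pre_body, pre_out, PICircuit.size, List.length_take,
    min_eq_left hj.le, Nat.add_sub_cancel, List.length_nil, Nat.add_zero, PICircuit.mk.injEq, and_true]
  rw [List.take_succ_eq_append_getElem hj, List.getD_eq_getElem _ _ hj]
  simp [hleaf]

/-- **Dead-weight elimination at a leaf.** If node `i` of the body `B` (`1 ≤ i ≤ |B|`) is a leaf
`ℓ` (a node invariant under shifting), then `F_i = ℓ` — the prefix WITH its dead weight equals the
one-node circuit — is realized in `P_c` over a commutative ring, cost `≤ 100M` for `M ≥ 3|B| + 7`: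
the C1 instance at the circuit `B.take i ++ [ℓ]` with output `(i-1) + i` reads
`F_{i-1} + ℓ = F_{i-1} + F_i`; cancel `F_{i-1}`. [folklore] -/
theorem Real.preLeaf {L : List (PICircuit 𝔽 X × PICircuit 𝔽 X)} {n : ℕ} (h : Real (pcSystem 𝔽 X) L n)
    (B : List (Node 𝔽 X)) {i : ℕ} (h1 : 1 ≤ i) (hi : i ≤ B.length)
    (hleaf : ∀ k, (B.getD i (.const 0)).shift k = B.getD i (.const 0)) {M : ℕ} (hM : 3 * B.length + 7 ≤ M) :
    Real (pcSystem 𝔽 X) ((pre B i, ⟨[], B.getD i (.const 0)⟩) :: L) (n + 100 * M) := by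
  set ℓ := B.getD i (.const 0) with hℓ
  -- the C1 instance `F_{i-1} + ℓ = F_{i-1} + F_i`
  have hC1 : (pcSystem 𝔽 X).IsAxiom .C1 (PICircuit.add (pre B (i - 1)) ⟨[], ℓ⟩)
      (PICircuit.add (pre B (i - 1)) (pre B i)) := by
    refine .inr ?_
    rw [add_pre_leaf B h1 hi ℓ hleaf]
    have hx := IsExtra.c1 (𝔽 := 𝔽) (B.take i ++ [ℓ]) (i - 1) i
    have e1 : (⟨B.take i ++ [ℓ], .add (i - 1) i⟩ : PICircuit 𝔽 X).prefixAt (i - 1) = pre B (i - 1) := by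
      have hlen : (B.take i).length = i := by simp [min_eq_left hi]
      simp only [PICircuit.prefixAt, pre, PICircuit.mk.injEq]
      constructor
      · rw [List.take_append_of_le_length (by omega), List.take_take, min_eq_left (by omega)]
      · rw [List.getD_append _ _ _ _ (by omega), getD_take_of_lt B (by omega)]
    have e2 : (⟨B.take i ++ [ℓ], .add (i - 1) i⟩ : PICircuit 𝔽 X).prefixAt i = pre B i := by
      have hlen : (B.take i).length = i := by simp [min_eq_left hi]
      simp only [PICircuit.prefixAt, pre, PICircuit.mk.injEq]
      constructor
      · rw [List.take_append_of_le_length (by omega), List.take_take, min_self]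
      · rw [List.getD_append_right _ _ _ _ (by omega), hlen, Nat.sub_self]; rfl
    rw [e1, e2] at hx
    exact hx
  have sA : (pre B (i - 1)).size = i - 1 + 1 := size_pre B (by omega)
  have sI : (pre B i).size = i + 1 := size_pre B hi
  have sL : (⟨[], ℓ⟩ : PICircuit 𝔽 X).size = 1 := rfl
  have s1 : (pcSystem 𝔽 X).size (PICircuit.add (pre B (i - 1)) ⟨[], ℓ⟩) ≤ M := by
    simp only [pcSystem, PICircuit.size_add, sL]; omega
  have s2 : (pcSystem 𝔽 X).size (PICircuit.add (pre B (i - 1)) (pre B i)) ≤ M := by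
    simp only [pcSystem, PICircuit.size_add]; omega
  have s3 : (pcSystem 𝔽 X).size (pre B i) ≤ M := by simp only [pcSystem]; omega
  have s4 : (pcSystem 𝔽 X).size (⟨[], ℓ⟩ : PICircuit 𝔽 X) ≤ M := by simp only [pcSystem, sL]; omega
  have r1 := h.axmB hC1 s1 s2
  have r2 := r1.cancel List.mem_cons_self (M := M) (by omega)
  have r3 := r2.symmB List.mem_cons_self s4 s3
  refine r3.mono (List.cons_subset_cons _ fun e he => ?_) (by omega)
  exact List.mem_cons_of_mem _ (List.mem_cons_of_mem _ he)

end Ring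

end PCR

open Literature.Computability.AlgebraicComplexity in
/-- **Dead-weight elimination at a leaf, `P_c(ℂ)` form** (registered helper toward the necessity of
stub T′ `stub_invarianceProvableQP'`, crux `RestorationQP`): inside any proof DAG, for a
straight-line body `B` whose node `i` (`1 ≤ i ≤ |B|`) is a leaf (shift-invariant), the line
`F_i = ℓ` (initial segment with output node `i` = the one-node circuit `ℓ`) is realized at cost
`100M`, `M ≥ 3|B| + 7`. [folklore] -/
theorem invarianceProvableQP_aux_preLeaf : ∀ (n : ℕ) (L : List (PICircuit ℂ (Fin n × Fin n) × PICircuit ℂ (Fin n × Fin n))) (m : ℕ) (B : List (PICircuit.Node ℂ (Fin n × Fin n))) (i M : ℕ), PCR.Real (pcSystem ℂ (Fin n × Fin n)) L m → 1 ≤ i → i ≤ B.length → (∀ k : ℕ, (B.getD i (PICircuit.Node.const 0)).shift k = B.getD i (PICircuit.Node.const 0)) → 3 * B.length + 7 ≤ M → PCR.Real (pcSystem ℂ (Fin n × Fin n)) (((⟨B.take i, B.getD i (PICircuit.Node.const 0)⟩ : PICircuit ℂ (Fin n × Fin n)), (⟨[], B.getD i (PICircuit.Node.const 0)⟩ : PICircuit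 ℂ (Fin n × Fin n))) :: L) (m + 100 * M) := by
  intro n L m B i M h h1 hi hleaf hM
  exact h.preLeaf B h1 hi hleaf hM

end Summit.ValiantsHypothesis.ValiantsHypothesis.Theorems
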